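import Summits.HodgeConjecture.CorCM.MumfordTateRankUnitaryPairCentre
import HarnessLib

/-!
# A bracket-closed subalgebra `𝔞 ⊆ 𝔥(H₁ ⊕ H₂)` mapping onto two unitary factors of DIFFERENT ranks contains both derived corners (counting),
# and — non-resonant `Θ`-slopes — both central directions (trace test): the two steps of the `Θ`-rigidity of a Ribet pair

COR-CM (cell `pub-hodgecm2`, seat `b27` gen 53, count-neutral Mumford–Tate-rank ladder; theorems only, no definition, no named fact; UNCONDITIONAL —
nothing here uses or asserts HC_CM).  ABSTRACT setting of `CorCM/MumfordTateRankUnitaryPair*` (a bicone `ι_i : H_i → H`, `π_i : H → H_i`).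
`Θ`-RIGIDITY of `H` (every bracket-closed rational `𝔞 ⊆ 𝔥(H)` with `Θ ∈ 𝔞 ⊗ ℂ` is all of `𝔥(H)`; the treeʼs substitute for «`MT(H ⊕ H′) ↠ MT(H)`»)
for `H = H¹(A × A′)`, `A`, `A′` Ribet-type of different dimensions, rests on the two lemmas below (sequel `CorCM/MumfordTateRankRibetTypeOnePairsRigid`):
* §1 `UnitaryPair.finrank_inf_ker_le_one_or`, **`UnitaryPair.corners_le_of_subalgebra_of_finrank_ne`** — COUNTING, no intertwiners: if the block
  restrictions `r_i(𝔞)` are all of `𝔥(H_i)` (rigid factors), `dim 𝔥(H_i) = m_i`, `𝔡_i = [𝔥(H_i),𝔥(H_i)]` simple of dimension `m_i − 1`, then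
  `dim 𝔞 = k₁ + m₂ = k₂ + m₁` with `k_i = dim (𝔞 ∩ ker r_j)`, and `K_i = r_i(𝔞 ∩ ker r_j)` is an ideal of `𝔥(H_i)` (lift and bracket), so
  `k_i ≤ 1` or (`k_i ≥ m_i − 1` and the corner `ι_i𝔡_iπ_i ⊆ 𝔞`); for `m₁ ≠ m₂` (`≥ 9`, differing by `≥ 2`) only the second survives on both sides.
* §2 **`UnitaryPair.incl_phi_proj_mem_of_subalgebra_of_nonresonant`** — gen 52ʼs TRACE TEST (`…UnitaryPairCentre`) run for `𝔞 ⊇ [𝔥,𝔥]` with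
  `Θ ∈ 𝔞 ⊗ ℂ`: `c₁ι₁φ₁π₁ + c₂ι₂φ₂π₂ ∈ (𝔞 ∩ plane) ⊗ ℂ`, `c_i tr(φ_i²) = σ_i k_i`, and a rational line through it would make `d₁/d₂` a square:
  so `ι₁φ₁π₁, ι₂φ₂π₂ ∈ 𝔞` when `d₁ ≠ s²d₂`.

## References
* [MoonenZarhin1999LowDim] B. Moonen, Yu. G. Zarhin, *Hodge classes on abelian varieties of low dimension*, Math. Ann. 315 (1999), §3 (3.1), Lemma (3.4),
  Prop. (3.8) [corpus: paper:arxiv-math_9901113 p. 6]. [cite: MoonenZarhin1999LowDim, §3 (3.1), Lemma (3.4) and Prop. (3.8)]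
* [Hazama1983] F. Hazama, Tôhoku Math. J. 35 (1983), Lemma (3.1). [cite: Hazama1983, Lemma (3.1)] · [Deligne1982HodgeCycles] P. Deligne, LNM 900 (1982), I §3 Prop. 3.4, Prop. 3.6. [cite: Deligne1982HodgeCycles, I §3 Prop. 3.6]
-/

noncomputable section

open scoped TensorProduct
open Module

namespace Summit.HodgeConjecture.CorCM

namespace UnitaryPair

open Literature.AlgebraicGeometry.Motives Literature.AlgebraicGeometry.Motives.HodgeStructure

universe u

variable {V₁ : Type u} [AddCommGroup V₁] [Module ℚ V₁] [Module.Finite ℚ V₁]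
  {V₂ : Type u} [AddCommGroup V₂] [Module ℚ V₂] [Module.Finite ℚ V₂]
  {V : Type u} [AddCommGroup V] [Module ℚ V] [Module.Finite ℚ V] [HodgeTensorFacts.{u, u}] {n : ℤ}
  {H₁ : HodgeStructure V₁ n} {H₂ : HodgeStructure V₂ n} {H : HodgeStructure V n}
  (ι₁ : Hom H₁ H) (π₁ : Hom H H₁) (ι₂ : Hom H₂ H) (π₂ : Hom H H₂)

/-! ## §1 Counting: a subalgebra mapping onto both unitary factors of different ranks contains both derived corners -/

/-- **One block.**  For a bracket-closed `𝔞 ⊆ 𝔥(H)` whose block restrictions are ONTO `𝔥(H₁)`, `𝔥(H₂)`, with `dim 𝔥(H₁) = m₁`, the derived algebra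
`𝔡₁` simple of dimension `m₁ − 1` (`m₁ ≥ 3`): writing `M₁ = 𝔞 ∩ ker r₂` (the elements of `𝔞` in block `1`), EITHER `dim M₁ ≤ 1`, OR
`dim M₁ ≥ m₁ − 1` and the corner `ι₁𝔡₁π₁` lies in `𝔞`; and `dim 𝔞 = dim M₁ + dim 𝔥(H₂)`. [cite: Hazama1983, Lemma (3.1)]
[cite: MoonenZarhin1999LowDim, §3 (3.1) and Lemma (3.4)] -/
theorem finrank_inf_ker_le_one_or
    (hπι₁ : ∀ v, π₁.toLinearMap (ι₁.toLinearMap v) = v) (hπι₂ : ∀ v, π₂.toLinearMap (ι₂.toLinearMap v) = v)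
    (hsum : ∀ v, ι₁.toLinearMap (π₁.toLinearMap v) + ι₂.toLinearMap (π₂.toLinearMap v) = v) (𝔞 : Submodule ℚ (Module.End ℚ V)) (h𝔞 : 𝔞 ≤ H.hodgeLie)
    (hbr : ∀ X ∈ 𝔞, ∀ Y ∈ 𝔞, X * Y - Y * X ∈ 𝔞)
    (himg₁ : 𝔞.map ((LinearMap.llcomp ℚ V₁ V V₁ π₁.toLinearMap).comp (LinearMap.lcomp ℚ V ι₁.toLinearMap)) = H₁.hodgeLie)
    (himg₂ : 𝔞.map ((LinearMap.llcomp ℚ V₂ V V₂ π₂.toLinearMap).comp (LinearMap.lcomp ℚ V ι₂.toLinearMap)) = H₂.hodgeLie)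
    {m₁ : ℕ} (hm₁ : Module.finrank ℚ H₁.hodgeLie = m₁)
    (h𝔡₁ : Module.finrank ℚ ↥(Submodule.span ℚ {B | ∃ X ∈ H₁.hodgeLie, ∃ Y ∈ H₁.hodgeLie, X * Y - Y * X = B}) = m₁ - 1)
    (hsimple₁ : ∀ 𝔡 I : Submodule ℚ (Module.End ℚ V₁), 𝔡 = Submodule.span ℚ {B | ∃ X ∈ H₁.hodgeLie, ∃ Y ∈ H₁.hodgeLie, X * Y - Y * X = B} →
      I ≤ 𝔡 → (∀ X ∈ 𝔡, ∀ Y ∈ I, X * Y - Y * X ∈ I) → I = ⊥ ∨ I = 𝔡) :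
    Module.finrank ℚ 𝔞 = Module.finrank ℚ ↥(𝔞 ⊓ LinearMap.ker ((LinearMap.llcomp ℚ V₂ V V₂ π₂.toLinearMap).comp (LinearMap.lcomp ℚ V ι₂.toLinearMap))) +
        Module.finrank ℚ H₂.hodgeLie ∧
      (Module.finrank ℚ ↥(𝔞 ⊓ LinearMap.ker ((LinearMap.llcomp ℚ V₂ V V₂ π₂.toLinearMap).comp (LinearMap.lcomp ℚ V ι₂.toLinearMap))) ≤ 1 ∨
        (m₁ - 1 ≤ Module.finrank ℚ ↥(𝔞 ⊓ LinearMap.ker ((LinearMap.llcomp ℚ V₂ V V₂ π₂.toLinearMap).comp (LinearMap.lcomp ℚ V ι₂.toLinearMap))) ∧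
          (Submodule.span ℚ {B | ∃ X ∈ H₁.hodgeLie, ∃ Y ∈ H₁.hodgeLie, X * Y - Y * X = B}).map
            ((LinearMap.llcomp ℚ V V₁ V ι₁.toLinearMap).comp (LinearMap.lcomp ℚ V₁ π₁.toLinearMap)) ≤ 𝔞)) := by
  classical
  set r₁ := (LinearMap.llcomp ℚ V₁ V V₁ π₁.toLinearMap).comp (LinearMap.lcomp ℚ V ι₁.toLinearMap) with hr₁def
  set r₂ := (LinearMap.llcomp ℚ V₂ V V₂ π₂.toLinearMap).comp (LinearMap.lcomp ℚ V ι₂.toLinearMap) with hr₂def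
  set L₁ := (LinearMap.llcomp ℚ V V₁ V ι₁.toLinearMap).comp (LinearMap.lcomp ℚ V₁ π₁.toLinearMap) with hL₁def
  set 𝔡₁ := Submodule.span ℚ {B | ∃ X ∈ H₁.hodgeLie, ∃ Y ∈ H₁.hodgeLie, X * Y - Y * X = B} with h𝔡₁def
  set M₁ := 𝔞 ⊓ LinearMap.ker r₂ with hM₁def
  have hr₁ : ∀ X, r₁ X = π₁.toLinearMap ∘ₗ X ∘ₗ ι₁.toLinearMap := fun X => rfl
  have hr₂ : ∀ X, r₂ X = π₂.toLinearMap ∘ₗ X ∘ₗ ι₂.toLinearMap := fun X => rfl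
  have hL₁ : ∀ Y, L₁ Y = ι₁.toLinearMap ∘ₗ Y ∘ₗ π₁.toLinearMap := fun Y => rfl
  have h𝔡𝔥₁ : 𝔡₁ ≤ H₁.hodgeLie := Submodule.span_le.2 (by rintro _ ⟨X, hX, Y, hY, rfl⟩; exact H₁.commutator_mem_hodgeLie hX hY)
  have hrL : ∀ Y, r₁ (L₁ Y) = Y := fun Y => by
    rw [hr₁, hL₁]; exact LinearMap.ext fun v => by simp only [LinearMap.comp_apply, hπι₁]
  -- `a ∈ M₁` lives in block `1`: `a = L₁ (r₁ a)`
  have hblock : ∀ a ∈ M₁, a = L₁ (r₁ a) := fun a ha => by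
    obtain ⟨ha𝔞, haker⟩ := Submodule.mem_inf.1 ha
    rw [LinearMap.mem_ker, hr₂] at haker
    have hb := eq_sum_blocks_of_mem_hodgeLie ι₁ π₁ ι₂ π₂ hπι₁ hπι₂ hsum (h𝔞 ha𝔞)
    rw [haker, LinearMap.zero_comp, LinearMap.comp_zero, add_zero] at hb
    rw [hL₁, hr₁]; exact hb
  -- (1) rank–nullity for `r₂|𝔞`
  have hrank : Module.finrank ℚ 𝔞 = Module.finrank ℚ M₁ + Module.finrank ℚ H₂.hodgeLie := by
    have h : Module.finrank ℚ ↥(𝔞.map r₂) + Module.finrank ℚ ↥(Submodule.comap 𝔞.subtype (LinearMap.ker r₂)) = Module.finrank ℚ ↥𝔞 := by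
      have h0 := LinearMap.finrank_range_add_finrank_ker (r₂.domRestrict 𝔞)
      rwa [LinearMap.range_domRestrict, LinearMap.ker_domRestrict] at h0
    have e : Module.finrank ℚ ↥(Submodule.comap 𝔞.subtype (LinearMap.ker r₂)) = Module.finrank ℚ M₁ := by
      have h1 : Submodule.comap 𝔞.subtype (LinearMap.ker r₂) = Submodule.comap 𝔞.subtype M₁ := by
        ext x; simp only [Submodule.mem_comap, Submodule.subtype_apply, hM₁def, Submodule.mem_inf, x.2, true_and]
      rw [h1]; exact (Submodule.comapSubtypeEquivOfLe (inf_le_left : M₁ ≤ 𝔞)).finrank_eq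
    have e2 : Module.finrank ℚ ↥(𝔞.map r₂) = Module.finrank ℚ H₂.hodgeLie := by rw [himg₂]
    rw [← h, e, e2, add_comm]
  -- (2) `K₁ = r₁(M₁)` is an ideal of `𝔥(H₁)` inside `𝔥(H₁)`
  set K₁ := M₁.map r₁ with hK₁def
  have hK₁𝔥 : K₁ ≤ H₁.hodgeLie := by
    rintro _ ⟨a, ha, rfl⟩; rw [hr₁]; exact comp_mem_hodgeLie_of_retract ι₁ π₁ hπι₁ (h𝔞 (Submodule.mem_inf.1 ha).1)
  have hK₁id : ∀ X ∈ H₁.hodgeLie, ∀ Y ∈ K₁, X * Y - Y * X ∈ K₁ := by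
    intro X hX Y hY
    obtain ⟨a, ha, rfl⟩ := hY
    obtain ⟨ha𝔞, haker⟩ := Submodule.mem_inf.1 ha
    rw [← himg₁] at hX
    obtain ⟨Xt, hXt, rfl⟩ := hX
    refine ⟨Xt * a - a * Xt, Submodule.mem_inf.2 ⟨hbr Xt hXt a ha𝔞, ?_⟩, ?_⟩
    · rw [LinearMap.mem_ker] at haker ⊢
      rw [map_sub, hr₂, hr₂, restrict_mul ι₂ π₂ hπι₂ (h𝔞 ha𝔞), restrict_mul ι₂ π₂ hπι₂ (h𝔞 hXt), ← hr₂ a, haker, mul_zero, zero_mul, sub_self]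
    · rw [map_sub]
      simp only [hr₁]
      rw [restrict_mul ι₁ π₁ hπι₁ (h𝔞 ha𝔞), restrict_mul ι₁ π₁ hπι₁ (h𝔞 hXt)]
  -- `dim K₁ = dim M₁` (`r₁` is injective on block `1`)
  have hKM : Module.finrank ℚ K₁ = Module.finrank ℚ M₁ := by
    have hi : Function.Injective (r₁.domRestrict M₁) := by
      intro x y hxy
      apply Subtype.ext
      rw [hblock x x.2, hblock y y.2]
      exact congrArg L₁ hxy
    rw [hK₁def, ← LinearMap.range_domRestrict, LinearMap.finrank_range_of_inj hi]
  -- (3) dichotomy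
  rcases hsimple₁ 𝔡₁ (K₁ ⊓ 𝔡₁) rfl inf_le_right (fun X hX Y hY => Submodule.mem_inf.2
      ⟨hK₁id X (h𝔡𝔥₁ hX) Y (Submodule.mem_inf.1 hY).1, Submodule.subset_span ⟨X, h𝔡𝔥₁ hX, Y, h𝔡𝔥₁ (Submodule.mem_inf.1 hY).2, rfl⟩⟩) with h0 | h0
  · refine ⟨hrank, Or.inl ?_⟩
    have h := Submodule.finrank_sup_add_finrank_inf_eq K₁ 𝔡₁
    rw [h0, finrank_bot, add_zero] at h
    have hle : Module.finrank ℚ ↥(K₁ ⊔ 𝔡₁) ≤ Module.finrank ℚ H₁.hodgeLie := Submodule.finrank_mono (sup_le hK₁𝔥 h𝔡𝔥₁)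
    have hK1 : Module.finrank ℚ ↥K₁ + Module.finrank ℚ ↥𝔡₁ ≤ m₁ := by rw [← h, ← hm₁]; exact hle
    have hd : Module.finrank ℚ ↥𝔡₁ = m₁ - 1 := h𝔡₁
    have hK1' : Module.finrank ℚ ↥K₁ ≤ 1 := by omega
    rw [← hKM]; exact hK1'
  · refine ⟨hrank, Or.inr ⟨?_, ?_⟩⟩
    · have hle : 𝔡₁ ≤ K₁ := h0 ▸ inf_le_left
      have h : Module.finrank ℚ ↥𝔡₁ ≤ Module.finrank ℚ ↥K₁ := Submodule.finrank_mono hle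
      have hd : Module.finrank ℚ ↥𝔡₁ = m₁ - 1 := h𝔡₁
      rw [← hKM]; omega
    · have hle : 𝔡₁ ≤ K₁ := h0 ▸ inf_le_left
      rintro _ ⟨Y, hY, rfl⟩
      obtain ⟨a, ha, hay⟩ := hle hY
      have hLa : L₁ Y = a := by rw [← hay, ← hblock a ha]
      rw [hLa]; exact (Submodule.mem_inf.1 ha).1

/-- **Both derived corners lie in `𝔞`, and `dim 𝔞 ≥ (m₁ − 1) + m₂`, `≥ (m₂ − 1) + m₁`**, when the unitary ranks `m₁ = dim 𝔥(H₁)`, `m₂ = dim 𝔥(H₂)` are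
DIFFERENT (`m_i = g_i²`, `g_i ≥ 3`, so `m_i ≥ 9` and `|m₁ − m₂| ≥ 2`): from `dim 𝔞 = k₁ + m₂ = k₂ + m₁` and `k_i ≤ 1 ∨ k_i ≥ m_i − 1` only `k_i ≥ m_i − 1`
survives. [cite: Hazama1983, Lemma (3.1)] [cite: MoonenZarhin1999LowDim, §3 (3.1) and Lemma (3.4)] -/
theorem corners_le_of_subalgebra_of_finrank_ne
    (hπι₁ : ∀ v, π₁.toLinearMap (ι₁.toLinearMap v) = v) (hπι₂ : ∀ v, π₂.toLinearMap (ι₂.toLinearMap v) = v)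
    (hsum : ∀ v, ι₁.toLinearMap (π₁.toLinearMap v) + ι₂.toLinearMap (π₂.toLinearMap v) = v)
    (𝔞 : Submodule ℚ (Module.End ℚ V)) (h𝔞 : 𝔞 ≤ H.hodgeLie)
    (hbr : ∀ X ∈ 𝔞, ∀ Y ∈ 𝔞, X * Y - Y * X ∈ 𝔞)
    (himg₁ : 𝔞.map ((LinearMap.llcomp ℚ V₁ V V₁ π₁.toLinearMap).comp (LinearMap.lcomp ℚ V ι₁.toLinearMap)) = H₁.hodgeLie)
    (himg₂ : 𝔞.map ((LinearMap.llcomp ℚ V₂ V V₂ π₂.toLinearMap).comp (LinearMap.lcomp ℚ V ι₂.toLinearMap)) = H₂.hodgeLie)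
    {m₁ m₂ : ℕ} (hm₁ : Module.finrank ℚ H₁.hodgeLie = m₁) (hm₂ : Module.finrank ℚ H₂.hodgeLie = m₂) (h9₁ : 9 ≤ m₁) (h9₂ : 9 ≤ m₂)
    (hne : m₁ + 2 ≤ m₂ ∨ m₂ + 2 ≤ m₁)
    (h𝔡₁ : Module.finrank ℚ ↥(Submodule.span ℚ {B | ∃ X ∈ H₁.hodgeLie, ∃ Y ∈ H₁.hodgeLie, X * Y - Y * X = B}) = m₁ - 1)
    (h𝔡₂ : Module.finrank ℚ ↥(Submodule.span ℚ {B | ∃ X ∈ H₂.hodgeLie, ∃ Y ∈ H₂.hodgeLie, X * Y - Y * X = B}) = m₂ - 1)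
    (hsimple₁ : ∀ 𝔡 I : Submodule ℚ (Module.End ℚ V₁), 𝔡 = Submodule.span ℚ {B | ∃ X ∈ H₁.hodgeLie, ∃ Y ∈ H₁.hodgeLie, X * Y - Y * X = B} →
      I ≤ 𝔡 → (∀ X ∈ 𝔡, ∀ Y ∈ I, X * Y - Y * X ∈ I) → I = ⊥ ∨ I = 𝔡)
    (hsimple₂ : ∀ 𝔡 I : Submodule ℚ (Module.End ℚ V₂), 𝔡 = Submodule.span ℚ {B | ∃ X ∈ H₂.hodgeLie, ∃ Y ∈ H₂.hodgeLie, X * Y - Y * X = B} →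
      I ≤ 𝔡 → (∀ X ∈ 𝔡, ∀ Y ∈ I, X * Y - Y * X ∈ I) → I = ⊥ ∨ I = 𝔡) :
    (Submodule.span ℚ {B | ∃ X ∈ H₁.hodgeLie, ∃ Y ∈ H₁.hodgeLie, X * Y - Y * X = B}).map
        ((LinearMap.llcomp ℚ V V₁ V ι₁.toLinearMap).comp (LinearMap.lcomp ℚ V₁ π₁.toLinearMap)) ≤ 𝔞 ∧
      (Submodule.span ℚ {B | ∃ X ∈ H₂.hodgeLie, ∃ Y ∈ H₂.hodgeLie, X * Y - Y * X = B}).map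
        ((LinearMap.llcomp ℚ V V₂ V ι₂.toLinearMap).comp (LinearMap.lcomp ℚ V₂ π₂.toLinearMap)) ≤ 𝔞 ∧
      m₁ - 1 + m₂ ≤ Module.finrank ℚ 𝔞 ∧ m₂ - 1 + m₁ ≤ Module.finrank ℚ 𝔞 := by
  have hsum' : ∀ v, ι₂.toLinearMap (π₂.toLinearMap v) + ι₁.toLinearMap (π₁.toLinearMap v) = v := fun v => by rw [add_comm]; exact hsum v
  obtain ⟨hrank₁, h₁⟩ := finrank_inf_ker_le_one_or ι₁ π₁ ι₂ π₂ hπι₁ hπι₂ hsum 𝔞 h𝔞 hbr himg₁ himg₂ hm₁ h𝔡₁ hsimple₁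
  obtain ⟨hrank₂, h₂⟩ := finrank_inf_ker_le_one_or ι₂ π₂ ι₁ π₁ hπι₂ hπι₁ hsum' 𝔞 h𝔞 hbr himg₂ himg₁ hm₂ h𝔡₂ hsimple₂
  rw [hm₂] at hrank₁
  rw [hm₁] at hrank₂
  rcases h₁ with h₁ | ⟨h₁, hc₁⟩ <;> rcases h₂ with h₂ | ⟨h₂, hc₂⟩
  · exfalso; omega
  · exfalso; omega
  · exfalso; omega
  · exact ⟨hc₁, hc₂, by omega, by omega⟩


/-! ## §2 The trace test for a subalgebra containing `[𝔥,𝔥]` -/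

section Centre

variable (hπι₁ : ∀ v, π₁.toLinearMap (ι₁.toLinearMap v) = v) (hπι₂ : ∀ v, π₂.toLinearMap (ι₂.toLinearMap v) = v)
  (hsum : ∀ v, ι₁.toLinearMap (π₁.toLinearMap v) + ι₂.toLinearMap (π₂.toLinearMap v) = v)
  {φ₁ : Module.End ℚ V₁} (hφ₁E : φ₁ ∈ H₁.endAlg) {φ₂ : Module.End ℚ V₂} (hφ₂E : φ₂ ∈ H₂.endAlg)
  (ψ : H.Polarization)
  (hZ : ∀ z ∈ H.hodgeLie ⊓ Subalgebra.toSubmodule H.endAlg, ∃ x₁ x₂ : ℚ,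
      z = x₁ • (ι₁.toLinearMap ∘ₗ φ₁ ∘ₗ π₁.toLinearMap) + x₂ • (ι₂.toLinearMap ∘ₗ φ₂ ∘ₗ π₂.toLinearMap))
  {d₁ : ℚ} (hd₁ : 0 < d₁) (hφ₁2 : φ₁ * φ₁ = -(d₁ • 1)) {d₂ : ℚ} (hd₂ : 0 < d₂) (hφ₂2 : φ₂ * φ₂ = -(d₂ • 1))
  {σ₁ σ₂ : ℂ} (hσ₁ : σ₁ ^ 2 = -(d₁ : ℂ)) (hσ₂ : σ₂ ^ 2 = -(d₂ : ℂ)) {k₁ k₂ : ℤ} (hk₁ : k₁ ≠ 0) (hk₂ : k₂ ≠ 0)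
  (hτ₁ : ∀ Θ₁ : Module.End ℂ (ℂ ⊗[ℚ] V₁), (∀ p, ∀ x ∈ H₁.piece p (n - p), Θ₁ x = ((2 * p - n : ℤ) : ℂ) • x) →
    LinearMap.trace ℂ _ (Θ₁ * φ₁.baseChange ℂ) = σ₁ * k₁)
  (hτ₂ : ∀ Θ₂ : Module.End ℂ (ℂ ⊗[ℚ] V₂), (∀ p, ∀ x ∈ H₂.piece p (n - p), Θ₂ x = ((2 * p - n : ℤ) : ℂ) • x) →
    LinearMap.trace ℂ _ (Θ₂ * φ₂.baseChange ℂ) = σ₂ * k₂)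
  (hfree : ∀ s : ℚ, d₁ ≠ s ^ 2 * d₂)

include hπι₁ hπι₂ hsum hφ₁E hφ₂E ψ hZ hd₁ hφ₁2 hd₂ hφ₂2 hσ₁ hσ₂ hk₁ hk₂ hτ₁ hτ₂ hfree in
set_option maxHeartbeats 800000 in
/-- **Non-resonant `Θ`-slopes put both `E₁ = ι₁φ₁π₁` and `E₂ = ι₂φ₂π₂` in every bracket-closed `𝔞 ⊆ 𝔥(H)` containing `[𝔥,𝔥]` with `Θ ∈ 𝔞 ⊗ ℂ`**
— the trace test of `CorCM/MumfordTateRankUnitaryPairCentre` run for `𝔞` in place of `𝔥(H)`: `Θ = c₁E₁ + c₂E₂ + Θ′`, `Θ′ ∈ [𝔥,𝔥] ⊗ ℂ ⊆ 𝔞 ⊗ ℂ`, so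
`c₁E₁ + c₂E₂ ∈ (𝔞 ∩ plane) ⊗ ℂ`; `c_i·tr(φ_i²) = σ_i k_i`; a LINE `𝔞 ∩ plane = ℚ(αE₁ + βE₂)` would give `d₁ = s²d₂`.
[cite: MoonenZarhin1999LowDim, §3 Lemma (3.4) and Prop. (3.8)] [cite: Deligne1982HodgeCycles, I §3 Prop. 3.6] -/
theorem incl_phi_proj_mem_of_subalgebra_of_nonresonant (𝔞 : Submodule ℚ (Module.End ℚ V)) (h𝔞 : 𝔞 ≤ H.hodgeLie)
    (h𝔡𝔞 : Submodule.span ℚ {B | ∃ X ∈ H.hodgeLie, ∃ Y ∈ H.hodgeLie, X * Y - Y * X = B} ≤ 𝔞)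
    {Θ : Module.End ℂ (ℂ ⊗[ℚ] V)} (hΘ : ∀ p, ∀ x ∈ H.piece p (n - p), Θ x = ((2 * p - n : ℤ) : ℂ) • x) (hΘ𝔞 : Θ ∈ spanC 𝔞) :
    ι₁.toLinearMap ∘ₗ φ₁ ∘ₗ π₁.toLinearMap ∈ 𝔞 ∧ ι₂.toLinearMap ∘ₗ φ₂ ∘ₗ π₂.toLinearMap ∈ 𝔞 := by
  classical
  have hΘ𝔤 : Θ ∈ spanC H.hodgeLie := spanC_mono h𝔞 hΘ𝔞
  obtain ⟨c₁, c₂, Θ', hΘ'𝔡, hΘdec⟩ := exists_theta_eq_center_add_derived ι₁ π₁ ι₂ π₂ ψ hZ hΘ𝔤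
  haveI : Nontrivial V₁ := by
    by_contra hV
    rw [not_nontrivial_iff_subsingleton] at hV
    obtain ⟨Θ₁, hΘ₁⟩ := exists_hodgeTheta H₁
    have h := hτ₁ Θ₁ hΘ₁
    have h0 : φ₁ = 0 := Subsingleton.elim _ _
    rw [h0, LinearMap.baseChange_zero, mul_zero, map_zero] at h
    have hσ : σ₁ = 0 := by
      rcases mul_eq_zero.1 h.symm with h' | h'
      · exact h'
      · exact absurd (by exact_mod_cast h') hk₁
    rw [hσ] at hσ₁; have : (d₁ : ℂ) = 0 := by simpa using hσ₁.symm
    exact hd₁.ne' (by exact_mod_cast this)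
  haveI : Nontrivial V₂ := by
    by_contra hV
    rw [not_nontrivial_iff_subsingleton] at hV
    obtain ⟨Θ₂, hΘ₂⟩ := exists_hodgeTheta H₂
    have h := hτ₂ Θ₂ hΘ₂
    have h0 : φ₂ = 0 := Subsingleton.elim _ _
    rw [h0, LinearMap.baseChange_zero, mul_zero, map_zero] at h
    have hσ : σ₂ = 0 := by
      rcases mul_eq_zero.1 h.symm with h' | h'
      · exact h'
      · exact absurd (by exact_mod_cast h') hk₂
    rw [hσ] at hσ₂; have : (d₂ : ℂ) = 0 := by simpa using hσ₂.symm
    exact hd₂.ne' (by exact_mod_cast this)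
  -- notation and block plumbing
  set ι₁C := ι₁.toLinearMap.baseChange ℂ with hι₁C
  set π₁C := π₁.toLinearMap.baseChange ℂ with hπ₁C
  set ι₂C := ι₂.toLinearMap.baseChange ℂ with hι₂C
  set π₂C := π₂.toLinearMap.baseChange ℂ with hπ₂C
  set φ₁C := φ₁.baseChange ℂ with hφ₁C
  set φ₂C := φ₂.baseChange ℂ with hφ₂C
  set E₁ : Module.End ℚ V := ι₁.toLinearMap ∘ₗ φ₁ ∘ₗ π₁.toLinearMap with hE₁
  set E₂ : Module.End ℚ V := ι₂.toLinearMap ∘ₗ φ₂ ∘ₗ π₂.toLinearMap with hE₂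
  set 𝔥 := 𝔞 with h𝔥def
  set 𝔡 : Submodule ℚ (Module.End ℚ V) := Submodule.span ℚ {B | ∃ X ∈ H.hodgeLie, ∃ Y ∈ H.hodgeLie, X * Y - Y * X = B} with h𝔡def
  have hπι₁' : π₁.toLinearMap ∘ₗ ι₁.toLinearMap = LinearMap.id := LinearMap.ext hπι₁
  have hπι₂' : π₂.toLinearMap ∘ₗ ι₂.toLinearMap = LinearMap.id := LinearMap.ext hπι₂
  have h11 : ∀ x, π₁C (ι₁C x) = x := fun x => proj_incl_baseChange hπι₁' x
  have h22 : ∀ x, π₂C (ι₂C x) = x := fun x => proj_incl_baseChange hπι₂' x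
  have h21 : ∀ x, π₂C (ι₁C x) = 0 := fun x => proj_incl_baseChange_eq_zero (proj₂_comp_incl₁ ι₁ π₁ ι₂ π₂ hπι₁ hπι₂ hsum) x
  have h12 : ∀ x, π₁C (ι₂C x) = 0 := fun x => proj_incl_baseChange_eq_zero (proj₁_comp_incl₂ ι₁ π₁ ι₂ π₂ hπι₁ hπι₂ hsum) x
  have hE₁C : E₁.baseChange ℂ = ι₁C ∘ₗ φ₁C ∘ₗ π₁C := by rw [hE₁, LinearMap.baseChange_comp, LinearMap.baseChange_comp]
  have hE₂C : E₂.baseChange ℂ = ι₂C ∘ₗ φ₂C ∘ₗ π₂C := by rw [hE₂, LinearMap.baseChange_comp, LinearMap.baseChange_comp]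
  have hq : ∀ (q : ℚ) (C : Module.End ℚ V), (q • C).baseChange ℂ = (q : ℂ) • C.baseChange ℂ := fun q C =>
    TensorProduct.AlgebraTensorModule.ext fun z v => by rw [LinearMap.baseChange_tmul, LinearMap.smul_apply, LinearMap.smul_apply,
      LinearMap.baseChange_tmul, TensorProduct.smul_tmul', ← TensorProduct.smul_tmul, Rat.smul_def, smul_eq_mul]
  have h𝔡𝔥 : 𝔡 ≤ 𝔥 := h𝔡𝔞
  -- traces: `tr(φ_i²) = -d_i dim V_i`
  have hν₁ : LinearMap.trace ℂ _ (φ₁C * φ₁C) = -((d₁ : ℂ) * (Module.finrank ℚ V₁ : ℂ)) := by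
    rw [hφ₁C, ← LinearMap.baseChange_mul, LinearMap.trace_baseChange, trace_mul_self_eq_of_sq_eq_neg hφ₁2, eq_ratCast]; push_cast; ring
  have hν₂ : LinearMap.trace ℂ _ (φ₂C * φ₂C) = -((d₂ : ℂ) * (Module.finrank ℚ V₂ : ℂ)) := by
    rw [hφ₂C, ← LinearMap.baseChange_mul, LinearMap.trace_baseChange, trace_mul_self_eq_of_sq_eq_neg hφ₂2, eq_ratCast]; push_cast; ring
  -- the blocks of `Θ` are the Hodge operators of the summands
  have hΘ₁ : ∀ p, ∀ x ∈ H₁.piece p (n - p), (π₁C ∘ₗ Θ ∘ₗ ι₁C) x = ((2 * p - n : ℤ) : ℂ) • x := fun p x hx => by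
    rw [LinearMap.comp_apply, LinearMap.comp_apply, hΘ p (ι₁C x) (ι₁.map_piece_le p _ ⟨x, hx, rfl⟩), map_smul, h11]
  have hΘ₂ : ∀ p, ∀ x ∈ H₂.piece p (n - p), (π₂C ∘ₗ Θ ∘ₗ ι₂C) x = ((2 * p - n : ℤ) : ℂ) • x := fun p x hx => by
    rw [LinearMap.comp_apply, LinearMap.comp_apply, hΘ p (ι₂C x) (ι₂.map_piece_le p _ ⟨x, hx, rfl⟩), map_smul, h22]
  -- the trace functionals applied to the decomposition of `Θ`
  have hr₁E₁ : π₁C ∘ₗ (ι₁C ∘ₗ φ₁C ∘ₗ π₁C) ∘ₗ ι₁C = φ₁C := LinearMap.ext fun x => by simp only [LinearMap.comp_apply, h11]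
  have hr₁E₂ : π₁C ∘ₗ (ι₂C ∘ₗ φ₂C ∘ₗ π₂C) ∘ₗ ι₁C = 0 := LinearMap.ext fun x => by
    simp only [LinearMap.comp_apply, h21, map_zero, LinearMap.zero_apply]
  have hr₂E₂ : π₂C ∘ₗ (ι₂C ∘ₗ φ₂C ∘ₗ π₂C) ∘ₗ ι₂C = φ₂C := LinearMap.ext fun x => by simp only [LinearMap.comp_apply, h22]
  have hr₂E₁ : π₂C ∘ₗ (ι₁C ∘ₗ φ₁C ∘ₗ π₁C) ∘ₗ ι₂C = 0 := LinearMap.ext fun x => by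
    simp only [LinearMap.comp_apply, h12, map_zero, LinearMap.zero_apply]
  have hc₁ : σ₁ * k₁ = c₁ * -((d₁ : ℂ) * (Module.finrank ℚ V₁ : ℂ)) := by
    have hΛ : LinearMap.trace ℂ _ ((π₁C ∘ₗ Θ' ∘ₗ ι₁C) * φ₁C) = 0 := trace_restrict₁_mul_eq_zero_of_mem_spanC_derived ι₁ π₁ hπι₁ hφ₁E hΘ'𝔡
    rw [← hτ₁ _ hΘ₁, ← hν₁]
    conv_lhs => rw [hΘdec]
    simp only [LinearMap.comp_add, LinearMap.add_comp, LinearMap.comp_smul, LinearMap.smul_comp, hr₁E₁, hr₁E₂, smul_zero, add_zero, add_mul,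
      map_add, smul_mul_assoc, map_smul, hΛ, smul_eq_mul]
  have hc₂ : σ₂ * k₂ = c₂ * -((d₂ : ℂ) * (Module.finrank ℚ V₂ : ℂ)) := by
    have hΛ : LinearMap.trace ℂ _ ((π₂C ∘ₗ Θ' ∘ₗ ι₂C) * φ₂C) = 0 := trace_restrict₁_mul_eq_zero_of_mem_spanC_derived ι₂ π₂ hπι₂ hφ₂E hΘ'𝔡
    rw [← hτ₂ _ hΘ₂, ← hν₂]
    conv_lhs => rw [hΘdec]
    simp only [LinearMap.comp_add, LinearMap.add_comp, LinearMap.comp_smul, LinearMap.smul_comp, hr₂E₁, hr₂E₂, smul_zero, zero_add, add_mul,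
      map_add, smul_mul_assoc, map_smul, hΛ, add_zero, smul_eq_mul]
  -- `ζ = c₁E₁ + c₂E₂ ∈ (𝔥 ∩ plane) ⊗ ℂ`
  set S : Submodule ℚ (Module.End ℚ V) := Submodule.span ℚ (({E₁, E₂} : Finset (Module.End ℚ V)) : Set (Module.End ℚ V)) with hSdef
  have hζ𝔥 : c₁ • (ι₁C ∘ₗ φ₁C ∘ₗ π₁C) + c₂ • (ι₂C ∘ₗ φ₂C ∘ₗ π₂C) ∈ spanC (𝔥 ⊓ S) := by
    rw [spanC_inf]
    refine Submodule.mem_inf.2 ⟨?_, ?_⟩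
    · have h : c₁ • (ι₁C ∘ₗ φ₁C ∘ₗ π₁C) + c₂ • (ι₂C ∘ₗ φ₂C ∘ₗ π₂C) = Θ - Θ' := by rw [hΘdec]; abel
      rw [h]
      exact Submodule.sub_mem _ hΘ𝔞 (spanC_mono h𝔡𝔥 hΘ'𝔡)
    · refine Submodule.add_mem _ (Submodule.smul_mem _ _ (Submodule.subset_span ⟨E₁, Submodule.subset_span (by simp), hE₁C⟩))
        (Submodule.smul_mem _ _ (Submodule.subset_span ⟨E₂, Submodule.subset_span (by simp), hE₂C⟩))
  -- if the plane is not inside `𝔥`, `𝔥 ∩ plane` is a line `ℚ(αE₁ + βE₂)`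
  by_contra hnot
  have hlt : 𝔥 ⊓ S < S := by
    refine lt_of_le_of_ne inf_le_right fun heq => hnot ?_
    have hS𝔥 : S ≤ 𝔥 := heq ▸ inf_le_left
    exact ⟨hS𝔥 (Submodule.subset_span (by simp)), hS𝔥 (Submodule.subset_span (by simp))⟩
  have hS2 : Module.finrank ℚ S ≤ 2 := (finrank_span_finset_le_card _).trans Finset.card_le_two
  have h1 : Module.finrank ℚ ↥(𝔥 ⊓ S) ≤ 1 := by
    have h := Submodule.finrank_lt_finrank_of_lt hlt
    omega
  obtain ⟨v, hv⟩ := finrank_le_one_iff.1 h1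
  have hvS : (v : Module.End ℚ V) ∈ Submodule.span ℚ (({E₁, E₂} : Finset (Module.End ℚ V)) : Set (Module.End ℚ V)) :=
    (Submodule.mem_inf.1 v.2).2
  rw [Finset.coe_pair] at hvS
  obtain ⟨α, β, hαβ⟩ := Submodule.mem_span_pair.1 hvS
  -- `ζ = λ (αE₁ + βE₂)_ℂ`
  have hline : spanC (𝔥 ⊓ S) ≤ ℂ ∙ ((v : Module.End ℚ V).baseChange ℂ) := by
    refine Submodule.span_le.2 ?_
    rintro _ ⟨w, hw, rfl⟩
    obtain ⟨c, hc⟩ := hv ⟨w, hw⟩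
    have hc' : w = c • (v : Module.End ℚ V) := by
      have := congrArg Subtype.val hc
      simpa using this.symm
    rw [SetLike.mem_coe]
    dsimp only
    rw [hc', hq]
    exact Submodule.smul_mem _ _ (Submodule.mem_span_singleton_self _)
  obtain ⟨lam, hlam⟩ := Submodule.mem_span_singleton.1 (hline hζ𝔥)
  rw [← hαβ, LinearMap.baseChange_add, hq, hq, hE₁C, hE₂C, smul_add, smul_smul, smul_smul] at hlam
  -- compare blocks: `c₁ = λα`, `c₂ = λβ`
  have hφ₁0 : φ₁C ≠ 0 := fun h0 => by
    have h := hν₁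
    rw [h0, mul_zero, map_zero] at h
    have h' : (d₁ : ℂ) * (Module.finrank ℚ V₁ : ℂ) = 0 := by rw [← neg_eq_zero, ← h]
    rcases mul_eq_zero.1 h' with h'' | h''
    · exact hd₁.ne' (by exact_mod_cast h'')
    · exact Module.finrank_pos.ne' (by exact_mod_cast h'')
  have hφ₂0 : φ₂C ≠ 0 := fun h0 => by
    have h := hν₂
    rw [h0, mul_zero, map_zero] at h
    have h' : (d₂ : ℂ) * (Module.finrank ℚ V₂ : ℂ) = 0 := by rw [← neg_eq_zero, ← h]
    rcases mul_eq_zero.1 h' with h'' | h''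
    · exact hd₂.ne' (by exact_mod_cast h'')
    · exact Module.finrank_pos.ne' (by exact_mod_cast h'')
  have hblk₁ : ∀ a b : ℂ, π₁C ∘ₗ (a • (ι₁C ∘ₗ φ₁C ∘ₗ π₁C) + b • (ι₂C ∘ₗ φ₂C ∘ₗ π₂C)) ∘ₗ ι₁C = a • φ₁C := fun a b => by
    simp only [LinearMap.comp_add, LinearMap.add_comp, LinearMap.comp_smul, LinearMap.smul_comp, hr₁E₁, hr₁E₂, smul_zero, add_zero]
  have hblk₂ : ∀ a b : ℂ, π₂C ∘ₗ (a • (ι₁C ∘ₗ φ₁C ∘ₗ π₁C) + b • (ι₂C ∘ₗ φ₂C ∘ₗ π₂C)) ∘ₗ ι₂C = b • φ₂C := fun a b => by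
    simp only [LinearMap.comp_add, LinearMap.add_comp, LinearMap.comp_smul, LinearMap.smul_comp, hr₂E₁, hr₂E₂, smul_zero, zero_add]
  have hcα : c₁ = lam * (α : ℂ) := by
    have h := congrArg (fun Z => π₁C ∘ₗ Z ∘ₗ ι₁C) hlam
    simp only [hblk₁] at h
    exact (smul_left_injective ℂ hφ₁0 h).symm
  have hcβ : c₂ = lam * (β : ℂ) := by
    have h := congrArg (fun Z => π₂C ∘ₗ Z ∘ₗ ι₂C) hlam
    simp only [hblk₂] at h
    exact (smul_left_injective ℂ hφ₂0 h).symm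
  -- arithmetic: `σ₁k₁ β d₂ N₂ = σ₂k₂ α d₁ N₁`, square it
  have hN₁ : (0 : ℚ) < Module.finrank ℚ V₁ := by exact_mod_cast Module.finrank_pos (R := ℚ) (M := V₁)
  have hN₂ : (0 : ℚ) < Module.finrank ℚ V₂ := by exact_mod_cast Module.finrank_pos (R := ℚ) (M := V₂)
  have hrel : σ₁ * k₁ * ((β * d₂ * Module.finrank ℚ V₂ : ℚ) : ℂ) = σ₂ * k₂ * ((α * d₁ * Module.finrank ℚ V₁ : ℚ) : ℂ) := by
    rw [hc₁, hc₂, hcα, hcβ]; push_cast; ring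
  have hsq : (d₁ : ℂ) * k₁ ^ 2 * ((β * d₂ * Module.finrank ℚ V₂ : ℚ) : ℂ) ^ 2 =
      (d₂ : ℂ) * k₂ ^ 2 * ((α * d₁ * Module.finrank ℚ V₁ : ℚ) : ℂ) ^ 2 := by
    have h := congrArg (fun z => z ^ 2) hrel
    simp only [mul_pow, hσ₁, hσ₂] at h
    linear_combination -h
  have hsqQ : d₁ * (k₁ : ℚ) ^ 2 * (β * d₂ * Module.finrank ℚ V₂) ^ 2 = d₂ * (k₂ : ℚ) ^ 2 * (α * d₁ * Module.finrank ℚ V₁) ^ 2 := by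
    exact_mod_cast hsq
  -- `d₁ d₂ (d₂ (k₁βN₂)² − d₁ (k₂αN₁)²) = 0`
  have hmain : d₂ * ((k₁ : ℚ) * β * Module.finrank ℚ V₂) ^ 2 = d₁ * ((k₂ : ℚ) * α * Module.finrank ℚ V₁) ^ 2 := by
    have h : d₁ * d₂ * (d₂ * ((k₁ : ℚ) * β * Module.finrank ℚ V₂) ^ 2 - d₁ * ((k₂ : ℚ) * α * Module.finrank ℚ V₁) ^ 2) = 0 := by
      linear_combination hsqQ
    rcases mul_eq_zero.1 h with h' | h'
    · exact absurd h' (mul_ne_zero hd₁.ne' hd₂.ne')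
    · exact sub_eq_zero.1 h'
  by_cases hα : α = 0
  · -- then `β = 0`, `ζ = 0`, `σ₁k₁ = 0`
    have hβ : β = 0 := by
      rw [hα, mul_zero, zero_mul, zero_pow two_ne_zero, mul_zero] at hmain
      have h := (mul_eq_zero.1 hmain).resolve_left hd₂.ne'
      rw [sq_eq_zero_iff] at h
      rcases mul_eq_zero.1 h with h' | h'
      · exact (mul_eq_zero.1 h').resolve_left (by exact_mod_cast hk₁)
      · exact absurd h' hN₂.ne'
    have h0 : c₁ = 0 := by rw [hcα, hα, Rat.cast_zero, mul_zero]
    rw [h0, zero_mul] at hc₁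
    rcases mul_eq_zero.1 hc₁ with h' | h'
    · rw [h', zero_pow two_ne_zero] at hσ₁
      have : (d₁ : ℂ) = 0 := by rw [← neg_eq_zero, ← hσ₁]
      exact hd₁.ne' (by exact_mod_cast this)
    · exact hk₁ (by exact_mod_cast h')
  · refine hfree ((k₁ : ℚ) * β * Module.finrank ℚ V₂ / ((k₂ : ℚ) * α * Module.finrank ℚ V₁)) ?_
    have hden : (k₂ : ℚ) * α * Module.finrank ℚ V₁ ≠ 0 := mul_ne_zero (mul_ne_zero (by exact_mod_cast hk₂) hα) hN₁.ne'
    field_simp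
    linear_combination hmain.symm

end Centre

end UnitaryPair

end Summit.HodgeConjecture.CorCM

end
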